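import Mathlib
import Literature.NumberTheory.Transcendental.SemialgebraicMapsProofs
import Literature.NumberTheory.Transcendental.SemialgebraicVolume
import Literature.ModelTheory.ExponentialFields.SemialgebraicInterior

/-!
# Crux `SymplecticScissors.PlanarSAZylev` (stmt-KontsevichZagierPeriods-9848),
line `reservoir-peeling`, stub `stub_mosaic`: Boltianskii's mosaic lemma

For the pinned pseudogroup equivalence `E` (an open co-null `ℚ`-semialgebraic part of `A` is
carried by one `ℚ`-semialgebraic `C¹` injection with `|det| = 1` onto a co-null part of `B`), with
gluing and transitivity of `E` given as hypotheses, we prove the mosaic lemma for bounded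
`ℚ`-regions: if `volume B < volume A` then `E B W` for some `ℚ`-semialgebraic `W ⊆ A`.

Proof (Boltianskii 1978, §16 Lemma 12, with dyadic squares).  Translate `A` and `B` by a rational
vector into the positive box (rational translations are instances of `E`, `mosaic_translate`, and
preserve area).  Cut by the dyadic grid of level `j`: `B` meets at most `#outerIdx B` closed
squares and `A` contains `#innerIdx A` closed squares; both counts times `4⁻ʲ` tend to the areas
because the frontier of a `ℚ`-semialgebraic set is null
(`volume_frontier_eq_zero_of_isSemialgebraic`, `card_sub_card_mul_le`,
`tendsto_volume_cthickening_frontier`), so at some level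
`#outerIdx B ≤ #innerIdx A` (`mosaic_card_le`).  Choose an injection `σ` from the outer squares of
`B` to the inner squares of `A`; translate the piece of `B` in the `K`-th half-open square into the
`σ K`-th half-open square (a dyadic, hence rational, vector); the pieces are disjoint and cover
`B`, the targets are disjoint and lie in `A`; glue (`mosaic_glue`) and translate back.

Sources: V. G. Boltianskii, *Hilbert's Third Problem* (1978), §16 Lemma 12; the cube kit of
`Literature/NumberTheory/Transcendental/SemialgebraicVolume.lean`.  No new definitions.
-/

noncomputable section

open MeasureTheory Set
open Literature.NumberTheory.Transcendental Literature.ModelTheory.ExponentialFields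
open Filter Topology

namespace Summit.KontsevichZagierPeriods.SymplecticScissors.PlanarSAZylev

/-! ### Rational translations -/

/-- Translation by a rational vector is a `ℚ`-semialgebraic map of the plane (a polynomial map
with coordinates `Xᵢ + qᵢ`). [folklore] -/
theorem mosaic_isSemialgebraicMapOn_translate (v : Fin 2 → ℝ) (q : Fin 2 → ℚ)
    (hv : ∀ i, v i = q i) :
    IsSemialgebraicMapOn ℚ (univ : Set (Fin 2 → ℝ)) (fun x => x + v) := by
  refine (isSemialgebraicMapOn_aeval isSemialgebraic_univ
    (fun j => (MvPolynomial.X j + MvPolynomial.C (q j) : MvPolynomial (Fin 2) ℚ))).congr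
    fun x _ => ?_
  funext j
  simp [hv j]

/-- A translate of a `ℚ`-semialgebraic planar set by a rational vector is `ℚ`-semialgebraic.
[folklore] -/
theorem mosaic_isSemialgebraic_translate {P : Set (Fin 2 → ℝ)} (hP : IsSemialgebraic ℚ P)
    (v : Fin 2 → ℝ) (q : Fin 2 → ℚ) (hv : ∀ i, v i = q i) :
    IsSemialgebraic ℚ ((fun x => x + v) '' P) :=
  IsSemialgebraicMapOn.isSemialgebraic_image_holds (mosaic_isSemialgebraicMapOn_translate v q hv)
    (subset_univ P) hP

/-- The Jacobian determinant of a translation is `1` in absolute value. [folklore] -/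
theorem mosaic_det_translate (v p : Fin 2 → ℝ) : |(fderiv ℝ (fun x => x + v) p).det| = 1 := by
  have h : HasFDerivAt (fun x : Fin 2 → ℝ => x + v) (ContinuousLinearMap.id ℝ (Fin 2 → ℝ)) p :=
    (hasFDerivAt_id p).add_const v
  rw [h.fderiv]
  simp [ContinuousLinearMap.det]

/-- Translations preserve area. [folklore] -/
theorem mosaic_volume_translate (v : Fin 2 → ℝ) (S : Set (Fin 2 → ℝ)) :
    volume ((fun x => x + v) '' S) = volume S := by
  rw [image_add_right, measure_preimage_add_right]

/-- **Rational translations are instances of `E`**: for a `ℚ`-semialgebraic `P` and a rational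
vector `v`, `E P (P + v)`, witnessed by the translation restricted to the interior of `P`
(`P \ interior P` lies in the null frontier, `volume_frontier_eq_zero_of_isSemialgebraic`, and
translations preserve null sets). [folklore] -/
theorem mosaic_translate (E : Set (Fin 2 → ℝ) → Set (Fin 2 → ℝ) → Prop)
    (HE : ∀ A B : Set (Fin 2 → ℝ), E A B ↔
        ∃ (U : Set (Fin 2 → ℝ)) (Φ : (Fin 2 → ℝ) → (Fin 2 → ℝ)),
          U ⊆ A ∧ IsSemialgebraic ℚ U ∧ IsOpen U ∧ volume (A \ U) = 0 ∧
          IsSemialgebraicMapOn ℚ U Φ ∧ ContDiffOn ℝ 1 Φ U ∧ InjOn Φ U ∧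
          (∀ p ∈ U, |(fderiv ℝ Φ p).det| = 1) ∧ Φ '' U ⊆ B ∧ volume (B \ Φ '' U) = 0)
    {P : Set (Fin 2 → ℝ)} (hP : IsSemialgebraic ℚ P) (v : Fin 2 → ℝ) (q : Fin 2 → ℚ)
    (hv : ∀ i, v i = q i) : E P ((fun x => x + v) '' P) := by
  have hnull : volume (P \ interior P) = 0 := by
    refine measure_mono_null (fun x hx => ?_) (volume_frontier_eq_zero_of_isSemialgebraic hP)
    exact ⟨subset_closure hx.1, hx.2⟩
  have hinj : (fun x : Fin 2 → ℝ => x + v).Injective := fun _ _ h => add_right_cancel h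
  refine (HE _ _).2 ⟨interior P, fun x => x + v, interior_subset, isSemialgebraic_interior hP,
    isOpen_interior, hnull,
    (mosaic_isSemialgebraicMapOn_translate v q hv).mono (subset_univ _)
      (isSemialgebraic_interior hP),
    (contDiff_id.add contDiff_const).contDiffOn, hinj.injOn, fun p _ => mosaic_det_translate v p,
    image_mono interior_subset, ?_⟩
  rw [← image_sdiff hinj, mosaic_volume_translate, hnull]

/-- `E ∅ ∅` (the translate of `∅` is `∅`). [folklore] -/
theorem mosaic_empty (E : Set (Fin 2 → ℝ) → Set (Fin 2 → ℝ) → Prop)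
    (HE : ∀ A B : Set (Fin 2 → ℝ), E A B ↔
        ∃ (U : Set (Fin 2 → ℝ)) (Φ : (Fin 2 → ℝ) → (Fin 2 → ℝ)),
          U ⊆ A ∧ IsSemialgebraic ℚ U ∧ IsOpen U ∧ volume (A \ U) = 0 ∧
          IsSemialgebraicMapOn ℚ U Φ ∧ ContDiffOn ℝ 1 Φ U ∧ InjOn Φ U ∧
          (∀ p ∈ U, |(fderiv ℝ Φ p).det| = 1) ∧ Φ '' U ⊆ B ∧ volume (B \ Φ '' U) = 0) :
    E ∅ ∅ := by
  simpa using mosaic_translate E HE (P := ∅) isSemialgebraic_empty 0 0 fun i => by simp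

/-- A bounded planar set lies in a box `[-N, N]²` with `N ∈ ℕ`. [folklore] -/
theorem mosaic_exists_bound {S : Set (Fin 2 → ℝ)} (hS : Bornology.IsBounded S) :
    ∃ N : ℕ, ∀ x ∈ S, ∀ i, |x i| ≤ N := by
  obtain ⟨r, hr⟩ := hS.subset_closedBall 0
  refine ⟨⌈r⌉₊, fun x hx i => ?_⟩
  have h1 : ‖x‖ ≤ r := mem_closedBall_zero_iff.1 (hr hx)
  have h2 : |x i| ≤ ‖x‖ := by simpa [Real.norm_eq_abs] using norm_le_pi_norm x i
  exact h2.trans (h1.trans (Nat.le_ceil r))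

/-! ### Dyadic squares -/

/-- Half-open dyadic squares are `ℚ`-semialgebraic (cut out by `kᵢ/2ʲ ≤ xᵢ < (kᵢ+1)/2ʲ`).
[folklore] -/
theorem mosaic_isSemialgebraic_hoCube (j : ℕ) (k : Fin 2 → ℕ) :
    IsSemialgebraic ℚ (hoCube j k : Set (Fin 2 → ℝ)) := by
  have h : ∀ i : Fin 2, IsSemialgebraic ℚ
      {x : Fin 2 → ℝ | cubeLo j k i ≤ x i ∧ x i < cubeHi j k i} := by
    intro i
    have h1 := (isSemialgebraic_setOf_eval_pos (R := ℝ)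
      (MvPolynomial.C ((k i : ℚ) / 2 ^ j) - MvPolynomial.X i : MvPolynomial (Fin 2) ℚ)).compl
    have h2 := isSemialgebraic_setOf_eval_pos (R := ℝ)
      (MvPolynomial.C (((k i : ℚ) + 1) / 2 ^ j) - MvPolynomial.X i : MvPolynomial (Fin 2) ℚ)
    convert h1.inter h2 using 1
    ext x
    simp only [mem_setOf_eq, mem_inter_iff, mem_compl_iff, map_sub, MvPolynomial.aeval_X,
      MvPolynomial.aeval_C, eq_ratCast, cubeLo, cubeHi, sub_pos, not_lt]
    push_cast
    exact Iff.rfl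
  convert IsSemialgebraic.biInter Finset.univ _ (fun i _ => h i) using 1
  ext x
  simp [hoCube, mem_Ico]

/-- Translating a point of the half-open square `k` by the difference of lower corners lands in
the half-open square `k'`. [folklore] -/
theorem mosaic_add_mem_hoCube {j : ℕ} {k : Fin 2 → ℕ} (k' : Fin 2 → ℕ) {x : Fin 2 → ℝ}
    (hx : x ∈ hoCube j k) : x + (cubeLo j k' - cubeLo j k) ∈ hoCube j k' := by
  intro i _
  have h := hx i (mem_univ i)
  rw [mem_Ico] at h ⊢
  simp only [Pi.add_apply, Pi.sub_apply]
  have h1 := cubeHi_sub_cubeLo j k i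
  have h2 := cubeHi_sub_cubeLo j k' i
  constructor <;> linarith [h.1, h.2]

/-- The difference of two lower corners of dyadic squares is a rational (dyadic) vector.
[folklore] -/
theorem mosaic_cubeLo_sub_ratCast (j : ℕ) (k k' : Fin 2 → ℕ) (i : Fin 2) :
    (cubeLo j k' - cubeLo j k) i = ((((k' i : ℚ) - k i) / 2 ^ j : ℚ) : ℝ) := by
  simp only [Pi.sub_apply, cubeLo]
  push_cast
  ring

/-- The pieces of a set `S ⊆ [0, L/2ʲ)²` cut by the half-open squares of level `j` indexed by the
outer codes cover `S` (the covering step of `le_card_outerIdx_mul`). [folklore] -/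
theorem mosaic_cover {S : Set (Fin 2 → ℝ)} {j L : ℕ}
    (hS : ∀ x ∈ S, ∀ i, 0 ≤ x i ∧ x i * 2 ^ j < L) :
    (⋃ K ∈ outerIdx S j L, S ∩ hoCube j (digits 2 L K)) = S := by
  -- adapted from `Literature.NumberTheory.Transcendental.le_card_outerIdx_mul`
  classical
  refine subset_antisymm (iUnion₂_subset fun K _ => inter_subset_left) fun x hx => ?_
  set k : Fin 2 → ℕ := fun i => ⌊x i * 2 ^ j⌋₊ with hk
  have hxk : x ∈ hoCube j k := mem_hoCube_floor (fun i => (hS x hx i).1)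
  have hklt : ∀ i, k i < L := fun i =>
    (Nat.floor_lt (mul_nonneg (hS x hx i).1 (by positivity))).2 (hS x hx i).2
  obtain ⟨K, hKlt, hKk⟩ := exists_digits_eq k hklt
  refine mem_iUnion₂.2 ⟨K, ?_, hx, by rw [hKk]; exact hxk⟩
  show K ∈ outerIdx S j L
  simp only [outerIdx, Finset.mem_filter, Finset.mem_range]
  refine ⟨hKlt, ⟨x, ?_, hx⟩⟩
  rw [hKk]
  exact hoCube_subset_closedCube j k hxk

/-! ### Counting and gluing -/

/-- Splitting the outer count: `#outer · c = #inner · c + (#outer - #inner) · c`. [folklore] -/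
theorem mosaic_card_split (s : Set (Fin 2 → ℝ)) (j L : ℕ) (c : ENNReal) :
    ((outerIdx s j L).card : ENNReal) * c =
      (innerIdx s j L).card * c +
        (((outerIdx s j L).card - (innerIdx s j L).card : ℕ) : ENNReal) * c := by
  rw [← add_mul, ← Nat.cast_add,
    Nat.add_sub_of_le (Finset.card_le_card (innerIdx_subset_outerIdx s j L))]

/-- **The counting step**: if `a ≤ n_I c + g_A`, `n_O c ≤ b + g_B` and `g_A + g_B < a - b`
(`b` finite), then `n_O ≤ n_I`. [folklore] -/
theorem mosaic_card_le {a b gA gB c : ENNReal} {nO nI : ℕ} (hb : b ≠ ⊤)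
    (hA : a ≤ nI * c + gA) (hB : (nO : ENNReal) * c ≤ b + gB) (hgap : gA + gB < a - b) :
    nO ≤ nI := by
  by_contra h
  have h1 : ((nI : ENNReal) + 1) * c ≤ nO * c := by
    gcongr
    exact_mod_cast Nat.succ_le_of_lt (not_le.1 h)
  have hba : b ≤ a := (tsub_pos_iff_lt.1 (zero_le.trans_lt hgap)).le
  have h2 : a + c < a :=
    calc a + c ≤ nI * c + gA + c := add_le_add hA le_rfl
      _ = (nI + 1) * c + gA := by ring
      _ ≤ b + gB + gA := add_le_add (h1.trans hB) le_rfl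
      _ = b + (gA + gB) := by ring
      _ < b + (a - b) := ENNReal.add_lt_add_left hb hgap
      _ = a := add_tsub_cancel_of_le hba
  exact absurd h2 (not_lt.2 le_self_add)

/-- From `#s ≤ #t` an injection on `s` with values in `t`. [folklore] -/
theorem mosaic_exists_injOn {s t : Finset ℕ} (h : s.card ≤ t.card) :
    ∃ σ : ℕ → ℕ, (∀ K ∈ s, σ K ∈ t) ∧ Set.InjOn σ s := by
  classical
  obtain ⟨f⟩ : Nonempty (s ↪ t) := Function.Embedding.nonempty_of_card_le (by simpa using h)
  refine ⟨fun K => if hK : K ∈ s then (f ⟨K, hK⟩ : ℕ) else 0, fun K hK => ?_,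
    fun K hK K' hK' hKK' => ?_⟩
  · simp only [dif_pos hK]
    exact (f ⟨K, hK⟩).2
  · have hKs : K ∈ s := hK
    have hK's : K' ∈ s := hK'
    simp only [dif_pos hKs, dif_pos hK's] at hKK'
    exact congrArg Subtype.val (f.injective (Subtype.ext hKK'))

/-- **Gluing finitely many instances** with pairwise disjoint sources and pairwise disjoint
targets, by induction from the two-piece gluing hypothesis. [folklore] -/
theorem mosaic_glue (E : Set (Fin 2 → ℝ) → Set (Fin 2 → ℝ) → Prop) (h0 : E ∅ ∅)
    (hglue : ∀ A₁ A₂ B₁ B₂ : Set (Fin 2 → ℝ), volume (A₁ ∩ A₂) = 0 → Disjoint B₁ B₂ →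
      E A₁ B₁ → E A₂ B₂ → E (A₁ ∪ A₂) (B₁ ∪ B₂))
    (s : Finset ℕ) (P Q : ℕ → Set (Fin 2 → ℝ)) (hPQ : ∀ K ∈ s, E (P K) (Q K))
    (hP : (↑s : Set ℕ).PairwiseDisjoint P) (hQ : (↑s : Set ℕ).PairwiseDisjoint Q) :
    E (⋃ K ∈ s, P K) (⋃ K ∈ s, Q K) := by
  induction s using Finset.induction_on with
  | empty => simpa using h0
  | insert a s ha ih =>
    rw [Finset.coe_insert] at hP hQ
    rw [Finset.set_biUnion_insert, Finset.set_biUnion_insert]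
    have hne : ∀ K ∈ s, a ≠ K := fun K hK => (ne_of_mem_of_not_mem hK ha).symm
    refine hglue _ _ _ _ ?_ ?_ (hPQ a (Finset.mem_insert_self a s))
      (ih (fun K hK => hPQ K (Finset.mem_insert_of_mem hK)) (hP.subset (subset_insert _ _))
        (hQ.subset (subset_insert _ _)))
    · have hd : Disjoint (P a) (⋃ K ∈ s, P K) := disjoint_iUnion₂_right.2 fun K hK =>
        hP (mem_insert _ _) (mem_insert_of_mem _ hK) (hne K hK)
      rw [hd.inter_eq, measure_empty]
    · exact disjoint_iUnion₂_right.2 fun K hK =>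
        hQ (mem_insert _ _) (mem_insert_of_mem _ hK) (hne K hK)

/-! ### The mosaic lemma in the positive box -/

/-- **Mosaic lemma in the box** `[0, R)²`: for `ℚ`-semialgebraic `A, B ⊆ [0, R)²` with
`volume B < volume A` there is a `ℚ`-semialgebraic `W ⊆ A` with `E B W` (gluing of `E` being a
hypothesis). [cite: Boltianskii1978, §16 Lemma 12] -/
theorem mosaic_core (E : Set (Fin 2 → ℝ) → Set (Fin 2 → ℝ) → Prop)
    (HE : ∀ A B : Set (Fin 2 → ℝ), E A B ↔
        ∃ (U : Set (Fin 2 → ℝ)) (Φ : (Fin 2 → ℝ) → (Fin 2 → ℝ)),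
          U ⊆ A ∧ IsSemialgebraic ℚ U ∧ IsOpen U ∧ volume (A \ U) = 0 ∧
          IsSemialgebraicMapOn ℚ U Φ ∧ ContDiffOn ℝ 1 Φ U ∧ InjOn Φ U ∧
          (∀ p ∈ U, |(fderiv ℝ Φ p).det| = 1) ∧ Φ '' U ⊆ B ∧ volume (B \ Φ '' U) = 0)
    (hglue : ∀ A₁ A₂ B₁ B₂ : Set (Fin 2 → ℝ), volume (A₁ ∩ A₂) = 0 → Disjoint B₁ B₂ →
      E A₁ B₁ → E A₂ B₂ → E (A₁ ∪ A₂) (B₁ ∪ B₂))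
    {A B : Set (Fin 2 → ℝ)} (hA : IsSemialgebraic ℚ A) (hB : IsSemialgebraic ℚ B) {R : ℕ}
    (hAR : ∀ x ∈ A, ∀ i, 0 ≤ x i ∧ x i < R) (hBR : ∀ x ∈ B, ∀ i, 0 ≤ x i ∧ x i < R)
    (hvol : volume B < volume A) :
    ∃ W : Set (Fin 2 → ℝ), W ⊆ A ∧ IsSemialgebraic ℚ W ∧ E B W := by
  classical
  -- boundedness and finiteness of the areas
  have hbd : ∀ S : Set (Fin 2 → ℝ), (∀ x ∈ S, ∀ i, 0 ≤ x i ∧ x i < R) →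
      Bornology.IsBounded S := fun S hS =>
    (Metric.isBounded_Icc (0 : Fin 2 → ℝ) (fun _ => (R : ℝ))).subset fun x hx =>
      ⟨fun i => (hS x hx i).1, fun i => (hS x hx i).2.le⟩
  have hBfin : volume B ≠ ⊤ := ((hbd B hBR).measure_lt_top (μ := volume)).ne
  -- the level `j`
  have hten : Tendsto (fun j : ℕ => volume (Metric.cthickening (1 / 2 ^ j) (frontier A)) +
      volume (Metric.cthickening (1 / 2 ^ j) (frontier B))) atTop (𝓝 0) := by
    have h := (tendsto_volume_cthickening_frontier (hbd A hAR)
      (volume_frontier_eq_zero_of_isSemialgebraic hA)).add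
      (tendsto_volume_cthickening_frontier (hbd B hBR)
        (volume_frontier_eq_zero_of_isSemialgebraic hB))
    rwa [add_zero] at h
  obtain ⟨j, hj⟩ := (hten.eventually (eventually_lt_nhds (tsub_pos_of_lt hvol))).exists
  have hbox : ∀ S : Set (Fin 2 → ℝ), (∀ x ∈ S, ∀ i, 0 ≤ x i ∧ x i < R) →
      ∀ x ∈ S, ∀ i, 0 ≤ x i ∧ x i * 2 ^ j < ((R * 2 ^ j : ℕ) : ℝ) := by
    intro S hS x hx i
    refine ⟨(hS x hx i).1, ?_⟩
    push_cast
    exact mul_lt_mul_of_pos_right (hS x hx i).2 (by positivity)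
  -- the counts
  have hcA : volume A ≤ ((innerIdx A j (R * 2 ^ j)).card : ENNReal) *
      ENNReal.ofReal ((1 / 2 ^ j) ^ 2) + volume (Metric.cthickening (1 / 2 ^ j) (frontier A)) := by
    refine (le_card_outerIdx_mul A j (R * 2 ^ j) (hbox A hAR)).trans ?_
    rw [mosaic_card_split]
    exact add_le_add le_rfl (card_sub_card_mul_le A j (R * 2 ^ j))
  have hcB : ((outerIdx B j (R * 2 ^ j)).card : ENNReal) * ENNReal.ofReal ((1 / 2 ^ j) ^ 2) ≤
      volume B + volume (Metric.cthickening (1 / 2 ^ j) (frontier B)) := by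
    rw [mosaic_card_split]
    exact add_le_add (card_innerIdx_mul_le B j (R * 2 ^ j)) (card_sub_card_mul_le B j (R * 2 ^ j))
  obtain ⟨σ, hσmem, hσinj⟩ := mosaic_exists_injOn (mosaic_card_le hBfin hcA hcB hj)
  -- the pieces `P K` of `B` and their translates `Q K`
  obtain ⟨P, hP⟩ : ∃ P : ℕ → Set (Fin 2 → ℝ),
      ∀ K, P K = B ∩ hoCube j (digits 2 (R * 2 ^ j) K) := ⟨_, fun _ => rfl⟩
  obtain ⟨Q, hQ⟩ : ∃ Q : ℕ → Set (Fin 2 → ℝ), ∀ K, Q K =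
      (fun x => x + (cubeLo j (digits 2 (R * 2 ^ j) (σ K)) - cubeLo j (digits 2 (R * 2 ^ j) K))) ''
        P K := ⟨_, fun _ => rfl⟩
  have hPsa : ∀ K, IsSemialgebraic ℚ (P K) := fun K => by
    rw [hP]
    exact hB.inter (mosaic_isSemialgebraic_hoCube j _)
  have hQsa : ∀ K, IsSemialgebraic ℚ (Q K) := fun K => by
    rw [hQ]
    exact mosaic_isSemialgebraic_translate (hPsa K) _ _ (mosaic_cubeLo_sub_ratCast j _ _)
  have hPQ : ∀ K, E (P K) (Q K) := fun K => by
    rw [hQ]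
    exact mosaic_translate E HE (hPsa K) _ _ (mosaic_cubeLo_sub_ratCast j _ _)
  have hQsub : ∀ K, Q K ⊆ hoCube j (digits 2 (R * 2 ^ j) (σ K)) := fun K => by
    rw [hQ, hP]
    rintro _ ⟨x, hx, rfl⟩
    exact mosaic_add_mem_hoCube _ hx.2
  have hPd : (↑(outerIdx B j (R * 2 ^ j)) : Set ℕ).PairwiseDisjoint P := by
    intro K hK K' hK' hne
    have hd : Disjoint (hoCube j (digits 2 (R * 2 ^ j) K)) (hoCube j (digits 2 (R * 2 ^ j) K')) :=
      pairwiseDisjoint_hoCube_digits j _ (coe_outerIdx_subset B j _) hK hK' hne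
    show Disjoint (P K) (P K')
    rw [hP, hP]
    exact hd.mono inter_subset_right inter_subset_right
  have hIA : (↑(innerIdx A j (R * 2 ^ j)) : Set ℕ) ⊆ {K | K < (R * 2 ^ j) ^ 2} :=
    (Finset.coe_subset.2 (innerIdx_subset_outerIdx A j _)).trans (coe_outerIdx_subset A j _)
  have hQd : (↑(outerIdx B j (R * 2 ^ j)) : Set ℕ).PairwiseDisjoint Q := by
    intro K hK K' hK' hne
    have hd : Disjoint (hoCube j (digits 2 (R * 2 ^ j) (σ K)))
        (hoCube j (digits 2 (R * 2 ^ j) (σ K'))) :=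
      pairwiseDisjoint_hoCube_digits j _ hIA (hσmem K hK) (hσmem K' hK')
        fun h => hne (hσinj hK hK' h)
    exact hd.mono (hQsub K) (hQsub K')
  -- gluing
  have hcov : (⋃ K ∈ outerIdx B j (R * 2 ^ j), P K) = B := by
    simp_rw [hP]
    exact mosaic_cover (hbox B hBR)
  have hE := mosaic_glue E (mosaic_empty E HE) hglue (outerIdx B j (R * 2 ^ j)) P Q
    (fun K _ => hPQ K) hPd hQd
  rw [hcov] at hE
  refine ⟨⋃ K ∈ outerIdx B j (R * 2 ^ j), Q K, fun y hy => ?_,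
    IsSemialgebraic.biUnion _ Q fun K _ => hQsa K, hE⟩
  rw [mem_iUnion₂] at hy
  obtain ⟨K, hK, hyK⟩ := hy
  have hσK := hσmem K hK
  simp only [innerIdx, Finset.mem_filter] at hσK
  exact hσK.2 (hoCube_subset_closedCube j _ (hQsub K hyK))

/-- **Boltianskii's mosaic lemma** (stub `stub_mosaic`; Boltianskii 1978, §16 Lemma 12, for
bounded `ℚ`-regions): if `vol B < vol A` then `B` is equivalent to a `ℚ`-semialgebraic subset of
`A` — cut `B` by a fine dyadic grid and translate its pieces, by rational vectors, into distinct
dyadic squares contained in `A` (counts: `innerIdx`/`outerIdx`, `exists_card_sub_card_mul_le`,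
`volume_frontier_eq_zero_of_isSemialgebraic`).  Gluing and transitivity of `E` are hypotheses.
[cite: Boltianskii1978, §16 Lemma 12] -/
theorem stub_mosaic :
    ∀ (E : Set (Fin 2 → ℝ) → Set (Fin 2 → ℝ) → Prop),
      (∀ A B : Set (Fin 2 → ℝ), E A B ↔
        ∃ (U : Set (Fin 2 → ℝ)) (Φ : (Fin 2 → ℝ) → (Fin 2 → ℝ)),
          U ⊆ A ∧ IsSemialgebraic ℚ U ∧ IsOpen U ∧ volume (A \ U) = 0 ∧
          IsSemialgebraicMapOn ℚ U Φ ∧ ContDiffOn ℝ 1 Φ U ∧ InjOn Φ U ∧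
          (∀ p ∈ U, |(fderiv ℝ Φ p).det| = 1) ∧ Φ '' U ⊆ B ∧ volume (B \ Φ '' U) = 0) →
    (∀ A₁ A₂ B₁ B₂ : Set (Fin 2 → ℝ), volume (A₁ ∩ A₂) = 0 → Disjoint B₁ B₂ →
      E A₁ B₁ → E A₂ B₂ → E (A₁ ∪ A₂) (B₁ ∪ B₂)) →
    (∀ A B C : Set (Fin 2 → ℝ), E A B → E B C → E A C) →
    ∀ A B : Set (Fin 2 → ℝ), IsSemialgebraic ℚ A → IsSemialgebraic ℚ B →
      Bornology.IsBounded A → Bornology.IsBounded B → volume B < volume A →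
      ∃ W : Set (Fin 2 → ℝ), W ⊆ A ∧ IsSemialgebraic ℚ W ∧ E B W := by
  intro E HE hglue htrans A B hA hB hAb hBb hvol
  -- move `A` and `B` into the positive box by the rational translation `x ↦ x + (N, N)`
  obtain ⟨N, hN⟩ := mosaic_exists_bound (hAb.union hBb)
  have haq : ∀ i : Fin 2, (fun _ : Fin 2 => (N : ℝ)) i = ((fun _ : Fin 2 => (N : ℚ)) i : ℚ) :=
    fun i => by simp
  have haq' : ∀ i : Fin 2, (-fun _ : Fin 2 => (N : ℝ)) i = ((fun _ : Fin 2 => -(N : ℚ)) i : ℚ) :=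
    fun i => by simp
  have hbox : ∀ S ⊆ A ∪ B, ∀ y ∈ (fun x => x + fun _ : Fin 2 => (N : ℝ)) '' S, ∀ i,
      0 ≤ y i ∧ y i < ((2 * N + 1 : ℕ) : ℝ) := by
    rintro S hS _ ⟨x, hx, rfl⟩ i
    have h := abs_le.1 (hN x (hS hx) i)
    simp only [Pi.add_apply]
    push_cast
    constructor <;> linarith [h.1, h.2]
  obtain ⟨W', hW'A, hW'sa, hW'E⟩ := mosaic_core E HE hglue
    (mosaic_isSemialgebraic_translate hA _ _ haq) (mosaic_isSemialgebraic_translate hB _ _ haq)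
    (hbox A subset_union_left) (hbox B subset_union_right)
    (by rwa [mosaic_volume_translate, mosaic_volume_translate])
  refine ⟨(fun x => x + -fun _ : Fin 2 => (N : ℝ)) '' W', ?_,
    mosaic_isSemialgebraic_translate hW'sa _ _ haq', ?_⟩
  · rintro _ ⟨y, hy, rfl⟩
    obtain ⟨x, hx, rfl⟩ := hW'A hy
    simpa using hx
  · exact htrans _ _ _ (mosaic_translate E HE hB _ _ haq)
      (htrans _ _ _ hW'E (mosaic_translate E HE hW'sa _ _ haq'))

end Summit.KontsevichZagierPeriods.SymplecticScissors.PlanarSAZylev
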